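import Mathlib
import HarnessLib
import Summits.HubbardSuperconductivity.HubbardSuperconductivity.Theorems.KLProgrammeC4aUmkCurrencyIdentity
import Summits.HubbardSuperconductivity.HubbardSuperconductivity.Theorems.KLProgrammeC4aUmkNumerator

/-!
# Route `KLProgramme` — crux C4a, S3 brick (B4) «(U1)-HYBRID» part D-2b: THE DIRECT PART OF THE FIRST-ORDER LAYER, ONE LEVEL LINE — given the KEY-LEMMA row
# `|𝒜_φ| ≤ C₁|ē| + C₂|e| + C₃|ρ|` on the support of the cut-off, the loop-circle integral of `c·J·G·(K e)′(ē)` is bounded by the `k = 0` ENVELOPE line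
# `(J₀(C₁ + C₂|e|/m + C₃|ρ|/m) + B_cJ₀ + J₁)·∫ (max m |ē|)⁻¹ dv`

Cell `gate-hubbard-kl`, seat hubbard-kl-k3c3-p3 (g36; row «implicit-function / monotonicity route for μ(n)»).  Located brick for the (C)-closer lane / the (M4)
assembly of the first-order ϑ-layer (stub (C) `stub_twoLeg_curvature` of `KLRegimeEngineV17F2`, stmt-HubbardSuperconductivity-20437), memo
HOME/hubbard-kl-k3c3-p3/U1-CAUSTIC-SUP.md §19 «(U1)-HYBRID» (D-2).

WHY.  In the hybrid split the direct-sheet pieces of the first-order numerator (`(1 − c_d)·J·G` near tangency, `c_d(1 − c_C)·J·G` on the Cooper class) are counted in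
the CO-MOVING currency: by `…C4aUmkCurrencyIdentity` `G = 𝒜_φ − ∂_vē` pointwise, the slope part is a free integration by parts over the loop circle (periodic integrand,
no boundary term), and where the cut-off `c` is non-zero a KEY LEMMA (`…C4aKeyLemmaTangency` near (T); the near-(C) ratio-form instance, owed) gives
`|𝒜_φ| ≤ C₁|ē| + C₂|e| + C₃|ρ|`.  With the kernel envelopes `|K e u| ≤ (max m |u|)⁻¹`, `|(K e)′u| ≤ (max m |u|)⁻²` (`m = |e|` off the Fermi strip, `m = lo` on it) the
extra inverse power is repaid: `(C₁|ē| + C₂|e| + C₃|ρ|)(max m |ē|)⁻² ≤ (C₁ + C₂|e|/m + C₃|ρ|/m)(max m |ē|)⁻¹`.  This file is that bookkeeping for ONE level line (fixed `ϑ, e`),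
with the cut-off `c`, the smooth factor `J` and the key-lemma row carried abstractly:
* `intervalIntegral_periodic_mul_deriv_comp_eq` — IBP over a period with periodic boundary values (no boundary term);
* **`directPart_levelLine_abs_le`** (HEADLINE): `|∫_{−π}^{π} c(v)·J(v)·G(v)·(K e)′(ē(v)) dv| ≤ (J₀(C₁ + C₂|e|/m + C₃|ρ|/m) + (B_c J₀ + J₁))·∫_{−π}^{π} (max m |ē(v)|)⁻¹ dv`.
What is left above it: the level and `ϑ` layers = the `k = 0` dominator of B4-DIRECT-PACK (`absBubble_partnerBand_le_posLog`, positive levels; «(B4)-K0-NEG-LEVELS» owed) and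
the support localisation rows (`directSheet_excluded_of_modulus` contrapositive ⟹ `‖ϑ‖_𝕋 < W`; `norm_levelPoint_sub_ge_torusDist` ⟹ `‖v‖_𝕋 ≤ W`).
Sizes binder shape; pure calculus on landed objects; nothing asserts (C), K3 or superconductivity.
References: FST II CPAM 51 (1998) §3 [cite: FeldmanSalmhoferTrubowitz1998]; BGM 2006 §2.4 [cite: BenfattoGiulianiMastropietro2006].
-/

noncomputable section

namespace Summit.HubbardSuperconductivity.HubbardSuperconductivity.Theorems.C4a

set_option linter.dupNamespace false -- summit = problem name (single-conjunct summit), D-0017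

open Real Set Filter MeasureTheory intervalIntegral
open scoped Topology
open Literature.MathematicalPhysics.QuantumLattice Literature.MathematicalPhysics.QuantumLattice.BandSectorCounting Literature.Probability.LatticeModels
open Summit.HubbardSuperconductivity.HubbardSuperconductivity.Theorems.KLRegimeSplit
open Summit.HubbardSuperconductivity.HubbardSuperconductivity.Theorems.DispersionFlow
open Summit.HubbardSuperconductivity.HubbardSuperconductivity.Theorems.PerturbedFermiCurve

/-! ## §1 Integration by parts over a period -/

/-- **IBP with equal boundary values**: `u, w ∈ C¹`, `u(b)w(b) = u(a)w(a)` ⟹ `∫_a^b u·w′ = −∫_a^b u′·w`. [folklore] -/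
theorem intervalIntegral_mul_deriv_eq_neg_of_boundary {u w : ℝ → ℝ} {a b : ℝ} (hu : ContDiff ℝ 1 u) (hw : ContDiff ℝ 1 w)
    (hbd : u b * w b = u a * w a) :
    ∫ x in a..b, u x * deriv w x = -∫ x in a..b, deriv u x * w x := by
  have hud : ∀ x ∈ uIcc a b, HasDerivAt u (deriv u x) x := fun x _ => ((hu.differentiable (by norm_num)) x).hasDerivAt
  have hwd : ∀ x ∈ uIcc a b, HasDerivAt w (deriv w x) x := fun x _ => ((hw.differentiable (by norm_num)) x).hasDerivAt
  have h := intervalIntegral.integral_mul_deriv_eq_deriv_mul hud hwd ((hu.continuous_deriv le_rfl).intervalIntegrable _ _)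
    ((hw.continuous_deriv le_rfl).intervalIntegrable _ _)
  rw [h, hbd, sub_self, zero_sub]

section Sizes

variable {K : TrigPolyC4v} {A : ℝ} (hA : ∀ p : Momentum, ∀ j ≤ 2, ‖iteratedFDeriv ℝ j (frameShift K) p‖ ≤ A) (hA20 : A ≤ 1 / 20)
  (hd : klCurveD ≤ (bandBounds (show (-4 : ℝ) < -1.1 by norm_num) (show (-1.1 : ℝ) ≤ -0.1 by norm_num)
    (show (-0.1 : ℝ) < 0 by norm_num)).Dtmin - 2 * A)
  {μ r : ℝ} (hr : 0 < r) (hlo : (-1.1 : ℝ) < μ - r - A) (hhi : μ + r + A < -0.1)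
  {A₃ A₄ : ℝ} (hA₃ : ∀ p : Momentum, ‖iteratedFDeriv ℝ 3 (frameShift K) p‖ ≤ A₃)
  (hA₄ : ∀ p : Momentum, ‖iteratedFDeriv ℝ 4 (frameShift K) p‖ ≤ A₄)
  {K₁ K₂ : ℝ} (hK₁ : ∀ p : Momentum, ‖fderiv ℝ (frameLevel μ K) p‖ ≤ K₁) (hK₂ : ∀ p : Momentum, ‖iteratedFDeriv ℝ 2 (frameLevel μ K) p‖ ≤ K₂)
include hA hA20 hd hr hlo hhi hA₃ hA₄ hK₁ hK₂

set_option maxHeartbeats 400000 in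
omit hA20 hA₃ hA₄ hK₁ hK₂ in
/-- **THE DIRECT PART, ONE LEVEL LINE** (HEADLINE; see the module docstring): fixed configuration `(ρ, ϑ, θ)` and loop level `|e| < r`; cut-off `c ∈ C¹`, `|c| ≤ 1`,
`|c′| ≤ B_c`, `2π`-periodic; factor `J ∈ C¹`, `|J| ≤ J₀`, `|J′| ≤ J₁`, `2π`-periodic; kernel `K ∈ C¹` with envelopes `(max m |u|)⁻¹`, `(max m |u|)⁻²`, `m > 0`;
key-lemma row on the support of `c` ⟹
`|∫_{−π}^{π} c·J·G·K′(ē)| ≤ (J₀(C₁ + C₂|e|/m + C₃|ρ|/m) + (B_cJ₀ + J₁))·∫_{−π}^{π} (max m |ē|)⁻¹`. -/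
theorem directPart_levelLine_abs_le {ρ e : ℝ} (hρ : |ρ| < r) (he : |e| < r) (ϑ θ : ℝ) {c J Kr : ℝ → ℝ} {Bc J₀ J₁ m C₁ C₂ C₃ : ℝ}
    (hc : ContDiff ℝ 1 c) (hcb : ∀ v, |c v| ≤ 1) (hc1 : ∀ v, |deriv c v| ≤ Bc) (hcper : ∀ v, c (v + 2 * π) = c v)
    (hJ : ContDiff ℝ 1 J) (hJb : ∀ v, |J v| ≤ J₀) (hJ1 : ∀ v, |deriv J v| ≤ J₁) (hJper : ∀ v, J (v + 2 * π) = J v)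
    (hK : ContDiff ℝ 1 Kr) (hm : 0 < m) (hK0 : ∀ u, |Kr u| ≤ (max m |u|)⁻¹) (hK1 : ∀ u, |deriv Kr u| ≤ (max m |u|)⁻¹ ^ 2)
    (hC₁ : 0 ≤ C₁) (hC₂ : 0 ≤ C₂) (hC₃ : 0 ≤ C₃)
    (hkey : ∀ v, c v ≠ 0 → |deriv (fun ψ : ℝ => frameLevel μ K (levelPoint μ K 0 ψ + levelPoint μ K ρ (ϑ + ψ) - levelPoint μ K e (v + ψ))) θ| ≤
      C₁ * |frameLevel μ K (pairSumPath μ K ρ ϑ θ 0 - levelPoint μ K e (v + θ))| + C₂ * |e| + C₃ * |ρ|) :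
    |∫ v in (-π)..π, c v * J v * ((fderiv ℝ (frameLevel μ K) (pairSumPath μ K ρ ϑ θ 0 - levelPoint μ K e (v + θ)))
        (iteratedDeriv 1 (levelPoint μ K 0) θ + iteratedDeriv 1 (levelPoint μ K ρ) (ϑ + θ)) *
        deriv Kr (frameLevel μ K (pairSumPath μ K ρ ϑ θ 0 - levelPoint μ K e (v + θ))))| ≤
      (J₀ * (C₁ + C₂ * (|e| / m) + C₃ * (|ρ| / m)) + (Bc * J₀ + J₁)) *
        ∫ v in (-π)..π, (max m |frameLevel μ K (pairSumPath μ K ρ ϑ θ 0 - levelPoint μ K e (v + θ))|)⁻¹ := by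
  set 𝒜 : ℝ → ℝ := fun v => deriv (fun ψ : ℝ => frameLevel μ K (levelPoint μ K 0 ψ + levelPoint μ K ρ (ϑ + ψ) - levelPoint μ K e (v + ψ))) θ with h𝒜
  have hππ : -π ≤ π := by linarith [Real.pi_pos]
  have hgC : ContDiff ℝ 1 (fun x : ℝ => frameLevel μ K (pairSumPath μ K ρ ϑ θ 0 - levelPoint μ K e (x + θ))) := contDiff_partnerBand_pp_angle hA hd hlo hhi ρ he ϑ θ 1
  have hgc := hgC.continuous
  have hgper : (frameLevel μ K (pairSumPath μ K ρ ϑ θ 0 - levelPoint μ K e ((-π + 2 * π) + θ))) = (frameLevel μ K (pairSumPath μ K ρ ϑ θ 0 - levelPoint μ K e ((-π) + θ))) := by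
    rw [show -π + 2 * π + θ = -π + θ + 2 * π by ring, levelPoint_add_two_pi]
  have hJ0 : 0 ≤ J₀ := (abs_nonneg _).trans (hJb 0)
  have hBc0 : 0 ≤ Bc := (abs_nonneg _).trans (hc1 0)
  have hJ10 : 0 ≤ J₁ := (abs_nonneg _).trans (hJ1 0)
  -- §A the currency identity under the integral, numerator `X = c·J` (periodic boundary values)
  have hX : ContDiff ℝ 1 (fun v => c v * J v) := hc.mul hJ
  have hid := fun v => geomFactor_eq_anisotropy_sub_slope hA hd hr hlo hhi hρ he ϑ θ v
  -- the integrand splits pointwise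
  have hpt : ∀ v, c v * J v * ((fderiv ℝ (frameLevel μ K) (pairSumPath μ K ρ ϑ θ 0 - levelPoint μ K e (v + θ)))
        (iteratedDeriv 1 (levelPoint μ K 0) θ + iteratedDeriv 1 (levelPoint μ K ρ) (ϑ + θ)) * deriv Kr ((frameLevel μ K (pairSumPath μ K ρ ϑ θ 0 - levelPoint μ K e (v + θ))))) =
      c v * J v * (𝒜 v * deriv Kr ((frameLevel μ K (pairSumPath μ K ρ ϑ θ 0 - levelPoint μ K e (v + θ))))) + -((c v * J v) * deriv (fun x => Kr ((frameLevel μ K (pairSumPath μ K ρ ϑ θ 0 - levelPoint μ K e (x + θ))))) v) := by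
    intro v
    have hcomp : deriv (fun x => Kr ((frameLevel μ K (pairSumPath μ K ρ ϑ θ 0 - levelPoint μ K e (x + θ))))) v = deriv Kr ((frameLevel μ K (pairSumPath μ K ρ ϑ θ 0 - levelPoint μ K e (v + θ)))) * deriv (fun x : ℝ => frameLevel μ K (pairSumPath μ K ρ ϑ θ 0 - levelPoint μ K e (x + θ))) v :=
      ((((hK.differentiable (by norm_num)) ((frameLevel μ K (pairSumPath μ K ρ ϑ θ 0 - levelPoint μ K e (v + θ))))).hasDerivAt).comp v (((hgC.differentiable (by norm_num)) v).hasDerivAt)).deriv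
    rw [hid v, hcomp]; simp only [h𝒜]; ring
  -- continuity / integrability of the pieces
  have hKg : ContDiff ℝ 1 (fun x => Kr ((frameLevel μ K (pairSumPath μ K ρ ϑ θ 0 - levelPoint μ K e (x + θ))))) := hK.comp hgC
  have hG : Continuous fun v : ℝ => (fderiv ℝ (frameLevel μ K) (pairSumPath μ K ρ ϑ θ 0 - levelPoint μ K e (v + θ)))
      (iteratedDeriv 1 (levelPoint μ K 0) θ + iteratedDeriv 1 (levelPoint μ K ρ) (ϑ + θ)) := by
    have hfe : Continuous (fderiv ℝ (frameLevel μ K)) := (EngineV8.contDiff_frameLevel μ K (n := 1)).continuous_fderiv one_ne_zero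
    have hP : Continuous fun v : ℝ => pairSumPath μ K ρ ϑ θ 0 - levelPoint μ K e (v + θ) :=
      continuous_const.sub ((contDiff_levelPoint_of_sizes hA hd hlo hhi he 0).continuous.comp (continuous_id.add continuous_const))
    exact (hfe.comp hP).clm_apply continuous_const
  have h𝒜c : Continuous 𝒜 := by
    have heq : 𝒜 = fun v => (fderiv ℝ (frameLevel μ K) (pairSumPath μ K ρ ϑ θ 0 - levelPoint μ K e (v + θ)))
        (iteratedDeriv 1 (levelPoint μ K 0) θ + iteratedDeriv 1 (levelPoint μ K ρ) (ϑ + θ)) + deriv (fun x : ℝ => frameLevel μ K (pairSumPath μ K ρ ϑ θ 0 - levelPoint μ K e (x + θ))) v := by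
      funext v; simp only [h𝒜]; rw [hid v]; simp
    rw [heq]; exact hG.add (hgC.continuous_deriv le_rfl)
  have hKd : Continuous fun v => deriv Kr ((frameLevel μ K (pairSumPath μ K ρ ϑ θ 0 - levelPoint μ K e (v + θ)))) := (hK.continuous_deriv le_rfl).comp hgc
  have h1c : Continuous fun v => c v * J v * (𝒜 v * deriv Kr ((frameLevel μ K (pairSumPath μ K ρ ϑ θ 0 - levelPoint μ K e (v + θ))))) := (hc.continuous.mul hJ.continuous).mul (h𝒜c.mul hKd)
  have h2c : Continuous fun v => (c v * J v) * deriv (fun x => Kr ((frameLevel μ K (pairSumPath μ K ρ ϑ θ 0 - levelPoint μ K e (x + θ))))) v := (hc.continuous.mul hJ.continuous).mul (hKg.continuous_deriv le_rfl)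
  -- §B the slope part integrates by parts with no boundary term
  have hbd : (c π * J π) * Kr ((frameLevel μ K (pairSumPath μ K ρ ϑ θ 0 - levelPoint μ K e (π + θ)))) = (c (-π) * J (-π)) * Kr ((frameLevel μ K (pairSumPath μ K ρ ϑ θ 0 - levelPoint μ K e ((-π) + θ)))) := by
    have hπ2 : π = -π + 2 * π := by ring
    have h1 : c π = c (-π) := by
      calc c π = c (-π + 2 * π) := by rw [← hπ2]
        _ = c (-π) := hcper (-π)
    have h2 : J π = J (-π) := by
      calc J π = J (-π + 2 * π) := by rw [← hπ2]
        _ = J (-π) := hJper (-π)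
    have h3 : (frameLevel μ K (pairSumPath μ K ρ ϑ θ 0 - levelPoint μ K e (π + θ))) = (frameLevel μ K (pairSumPath μ K ρ ϑ θ 0 - levelPoint μ K e ((-π) + θ))) := by
      have : π = -π + 2 * π := by ring
      calc (frameLevel μ K (pairSumPath μ K ρ ϑ θ 0 - levelPoint μ K e (π + θ))) = (frameLevel μ K (pairSumPath μ K ρ ϑ θ 0 - levelPoint μ K e ((-π + 2 * π) + θ))) := by rw [← this]
        _ = (frameLevel μ K (pairSumPath μ K ρ ϑ θ 0 - levelPoint μ K e ((-π) + θ))) := hgper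
    rw [h1, h2, h3]
  have hibp := intervalIntegral_mul_deriv_eq_neg_of_boundary (a := -π) (b := π) hX hKg hbd
  -- §C pointwise envelopes
  have henv1 : ∀ v, |c v * J v * (𝒜 v * deriv Kr ((frameLevel μ K (pairSumPath μ K ρ ϑ θ 0 - levelPoint μ K e (v + θ)))))| ≤ J₀ * (C₁ + C₂ * (|e| / m) + C₃ * (|ρ| / m)) * (max m |(frameLevel μ K (pairSumPath μ K ρ ϑ θ 0 - levelPoint μ K e (v + θ)))|)⁻¹ := by
    intro v
    have hM : 0 < max m |(frameLevel μ K (pairSumPath μ K ρ ϑ θ 0 - levelPoint μ K e (v + θ)))| := lt_max_of_lt_left hm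
    have hMinv : 0 ≤ (max m |(frameLevel μ K (pairSumPath μ K ρ ϑ θ 0 - levelPoint μ K e (v + θ)))|)⁻¹ := inv_nonneg.2 hM.le
    by_cases hcv : c v = 0
    · rw [hcv]; simp only [zero_mul, abs_zero]; positivity
    have hk := hkey v hcv
    have hgle : |(frameLevel μ K (pairSumPath μ K ρ ϑ θ 0 - levelPoint μ K e (v + θ)))| ≤ max m |(frameLevel μ K (pairSumPath μ K ρ ϑ θ 0 - levelPoint μ K e (v + θ)))| := le_max_right _ _
    have hmM : m ≤ max m |(frameLevel μ K (pairSumPath μ K ρ ϑ θ 0 - levelPoint μ K e (v + θ)))| := le_max_left _ _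
    have hele : |e| ≤ |e| / m * max m |(frameLevel μ K (pairSumPath μ K ρ ϑ θ 0 - levelPoint μ K e (v + θ)))| := by
      have : |e| / m * m ≤ |e| / m * max m |(frameLevel μ K (pairSumPath μ K ρ ϑ θ 0 - levelPoint μ K e (v + θ)))| := mul_le_mul_of_nonneg_left hmM (div_nonneg (abs_nonneg _) hm.le)
      rwa [div_mul_cancel₀ _ hm.ne'] at this
    have hρle : |ρ| ≤ |ρ| / m * max m |(frameLevel μ K (pairSumPath μ K ρ ϑ θ 0 - levelPoint μ K e (v + θ)))| := by
      have : |ρ| / m * m ≤ |ρ| / m * max m |(frameLevel μ K (pairSumPath μ K ρ ϑ θ 0 - levelPoint μ K e (v + θ)))| := mul_le_mul_of_nonneg_left hmM (div_nonneg (abs_nonneg _) hm.le)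
      rwa [div_mul_cancel₀ _ hm.ne'] at this
    have h𝒜le : |𝒜 v| ≤ (C₁ + C₂ * (|e| / m) + C₃ * (|ρ| / m)) * max m |(frameLevel μ K (pairSumPath μ K ρ ϑ θ 0 - levelPoint μ K e (v + θ)))| := by
      calc |𝒜 v| ≤ C₁ * |(frameLevel μ K (pairSumPath μ K ρ ϑ θ 0 - levelPoint μ K e (v + θ)))| + C₂ * |e| + C₃ * |ρ| := hk
        _ ≤ C₁ * max m |(frameLevel μ K (pairSumPath μ K ρ ϑ θ 0 - levelPoint μ K e (v + θ)))| + C₂ * (|e| / m * max m |(frameLevel μ K (pairSumPath μ K ρ ϑ θ 0 - levelPoint μ K e (v + θ)))|) + C₃ * (|ρ| / m * max m |(frameLevel μ K (pairSumPath μ K ρ ϑ θ 0 - levelPoint μ K e (v + θ)))|) := by gcongr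
        _ = (C₁ + C₂ * (|e| / m) + C₃ * (|ρ| / m)) * max m |(frameLevel μ K (pairSumPath μ K ρ ϑ θ 0 - levelPoint μ K e (v + θ)))| := by ring
    have hKle := hK1 ((frameLevel μ K (pairSumPath μ K ρ ϑ θ 0 - levelPoint μ K e (v + θ))))
    rw [abs_mul, abs_mul, abs_mul]
    have hX0 : 0 ≤ (C₁ + C₂ * (|e| / m) + C₃ * (|ρ| / m)) * max m |(frameLevel μ K (pairSumPath μ K ρ ϑ θ 0 - levelPoint μ K e (v + θ)))| := by positivity
    have hAK : |𝒜 v| * |deriv Kr ((frameLevel μ K (pairSumPath μ K ρ ϑ θ 0 - levelPoint μ K e (v + θ))))| ≤ (C₁ + C₂ * (|e| / m) + C₃ * (|ρ| / m)) * max m |(frameLevel μ K (pairSumPath μ K ρ ϑ θ 0 - levelPoint μ K e (v + θ)))| * (max m |(frameLevel μ K (pairSumPath μ K ρ ϑ θ 0 - levelPoint μ K e (v + θ)))|)⁻¹ ^ 2 :=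
      mul_le_mul h𝒜le hKle (abs_nonneg _) hX0
    have hcJ : |c v| * |J v| ≤ 1 * J₀ := mul_le_mul (hcb v) (hJb v) (abs_nonneg _) zero_le_one
    calc |c v| * |J v| * (|𝒜 v| * |deriv Kr ((frameLevel μ K (pairSumPath μ K ρ ϑ θ 0 - levelPoint μ K e (v + θ))))|)
        ≤ 1 * J₀ * ((C₁ + C₂ * (|e| / m) + C₃ * (|ρ| / m)) * max m |(frameLevel μ K (pairSumPath μ K ρ ϑ θ 0 - levelPoint μ K e (v + θ)))| * (max m |(frameLevel μ K (pairSumPath μ K ρ ϑ θ 0 - levelPoint μ K e (v + θ)))|)⁻¹ ^ 2) :=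
          mul_le_mul hcJ hAK (mul_nonneg (abs_nonneg _) (abs_nonneg _)) (by positivity)
      _ = J₀ * (C₁ + C₂ * (|e| / m) + C₃ * (|ρ| / m)) * (max m |(frameLevel μ K (pairSumPath μ K ρ ϑ θ 0 - levelPoint μ K e (v + θ)))|)⁻¹ := by field_simp
  have henv2 : ∀ v, |(c v * J v) * deriv (fun x => Kr ((frameLevel μ K (pairSumPath μ K ρ ϑ θ 0 - levelPoint μ K e (x + θ))))) v| ≤ 0 ∨ True := fun v => Or.inr trivial
  have henv2' : ∀ v, |deriv (fun v => c v * J v) v * Kr ((frameLevel μ K (pairSumPath μ K ρ ϑ θ 0 - levelPoint μ K e (v + θ))))| ≤ (Bc * J₀ + J₁) * (max m |(frameLevel μ K (pairSumPath μ K ρ ϑ θ 0 - levelPoint μ K e (v + θ)))|)⁻¹ := by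
    intro v
    have hM : 0 < max m |(frameLevel μ K (pairSumPath μ K ρ ϑ θ 0 - levelPoint μ K e (v + θ)))| := lt_max_of_lt_left hm
    have hprod : deriv (fun v => c v * J v) v = deriv c v * J v + c v * deriv J v :=
      ((((hc.differentiable (by norm_num)) v).hasDerivAt).mul (((hJ.differentiable (by norm_num)) v).hasDerivAt)).deriv
    rw [hprod, abs_mul]
    have h1 : |deriv c v * J v + c v * deriv J v| ≤ Bc * J₀ + 1 * J₁ := by
      refine (abs_add_le _ _).trans ?_
      rw [abs_mul, abs_mul]
      gcongr
      · exact hc1 v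
      · exact hJb v
      · exact hcb v
      · exact hJ1 v
    rw [one_mul] at h1
    exact mul_le_mul h1 (hK0 ((frameLevel μ K (pairSumPath μ K ρ ϑ θ 0 - levelPoint μ K e (v + θ))))) (abs_nonneg _) (by positivity)
  -- §D assemble
  have hI1 : IntervalIntegrable (fun v => c v * J v * (𝒜 v * deriv Kr ((frameLevel μ K (pairSumPath μ K ρ ϑ θ 0 - levelPoint μ K e (v + θ)))))) volume (-π) π := h1c.intervalIntegrable _ _
  have hI2 : IntervalIntegrable (fun v => -((c v * J v) * deriv (fun x => Kr ((frameLevel μ K (pairSumPath μ K ρ ϑ θ 0 - levelPoint μ K e (x + θ))))) v)) volume (-π) π := (h2c.intervalIntegrable _ _).neg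
  have hEc : Continuous fun v => (max m |(frameLevel μ K (pairSumPath μ K ρ ϑ θ 0 - levelPoint μ K e (v + θ)))|)⁻¹ :=
    (continuous_const.max (continuous_abs.comp hgc)).inv₀ fun v => (lt_max_of_lt_left hm).ne'
  rw [intervalIntegral.integral_congr (fun v _ => hpt v), intervalIntegral.integral_add hI1 hI2, intervalIntegral.integral_neg, hibp, neg_neg]
  have hA1 : |∫ v in (-π)..π, c v * J v * (𝒜 v * deriv Kr ((frameLevel μ K (pairSumPath μ K ρ ϑ θ 0 - levelPoint μ K e (v + θ)))))| ≤ ∫ v in (-π)..π, J₀ * (C₁ + C₂ * (|e| / m) + C₃ * (|ρ| / m)) * (max m |(frameLevel μ K (pairSumPath μ K ρ ϑ θ 0 - levelPoint μ K e (v + θ)))|)⁻¹ := by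
    have h := intervalIntegral.norm_integral_le_of_norm_le (μ := volume) hππ (f := fun v => c v * J v * (𝒜 v * deriv Kr ((frameLevel μ K (pairSumPath μ K ρ ϑ θ 0 - levelPoint μ K e (v + θ))))))
      (g := fun v => J₀ * (C₁ + C₂ * (|e| / m) + C₃ * (|ρ| / m)) * (max m |(frameLevel μ K (pairSumPath μ K ρ ϑ θ 0 - levelPoint μ K e (v + θ)))|)⁻¹)
      (Filter.Eventually.of_forall fun v _ => by simpa only [Real.norm_eq_abs] using henv1 v)
      ((continuous_const.mul hEc).intervalIntegrable _ _)
    simpa only [Real.norm_eq_abs] using h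
  have hA2 : |∫ v in (-π)..π, deriv (fun v => c v * J v) v * Kr ((frameLevel μ K (pairSumPath μ K ρ ϑ θ 0 - levelPoint μ K e (v + θ))))| ≤ ∫ v in (-π)..π, (Bc * J₀ + J₁) * (max m |(frameLevel μ K (pairSumPath μ K ρ ϑ θ 0 - levelPoint μ K e (v + θ)))|)⁻¹ := by
    have h := intervalIntegral.norm_integral_le_of_norm_le (μ := volume) hππ (f := fun v => deriv (fun v => c v * J v) v * Kr ((frameLevel μ K (pairSumPath μ K ρ ϑ θ 0 - levelPoint μ K e (v + θ)))))
      (g := fun v => (Bc * J₀ + J₁) * (max m |(frameLevel μ K (pairSumPath μ K ρ ϑ θ 0 - levelPoint μ K e (v + θ)))|)⁻¹)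
      (Filter.Eventually.of_forall fun v _ => by simpa only [Real.norm_eq_abs] using henv2' v)
      ((continuous_const.mul hEc).intervalIntegrable _ _)
    simpa only [Real.norm_eq_abs] using h
  rw [intervalIntegral.integral_const_mul] at hA1 hA2
  refine (abs_add_le _ _).trans ((add_le_add hA1 hA2).trans (le_of_eq ?_))
  ring

end Sizes

end Summit.HubbardSuperconductivity.HubbardSuperconductivity.Theorems.C4a

end
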